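import Summits.AtomisticToContinuum.Crystallization.Theorems.FrustratedLawDichotomyTailFloorSharp
import Summits.AtomisticToContinuum.Crystallization.Theorems.FrustratedLawDichotomyRangeCut

/-!
# FrustratedLawDichotomy · lens-5 g33's RANGE CUT with the tail floor DISCHARGED BY NAME

`…RangeCut` (lens-5 g33, landed by hand-2) cuts the energetic residual `FDG` of column 27623 by range with THREE inputs beneath `T′`
(critic row 480: declared residual of lens-5 := `T′_5`): `TF` `TailFloor R A` [KNOWN-type], `UP` `PeriodicEnergyCeiling eUp` [tree number],
`T′_R` `FiniteRangeTopologicalPricing` [residual · BARRIER].  `…TailFloor` / `…TailFloorSharp` (this hand, p826770 / p826874) PROVE the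
tail floor in raw form with `A_R = (4/3)(1 + 1/(2R))³/R³`; here it is read in lens-5's currency and threaded through every kernel:

* ★ `tailFloor_holds : 0 < R → TailFloor R ((4/3)(1+1/(2R))³/R³)`, literals `tailFloor_five : TailFloor 5 (71/5000)`,
  `tailFloor_eight : TailFloor 8 (5/1600)`, and the dyadic `tailFloor_dyadic` (`(128/21)(1+1/(4R))³/R³`);
* `topologicalPricing_of_rangeCut_tf`, `fdg_of_split_rangeCut_tf`, `fdg_of_rangeCut_tf` — lens-5's kernels with `hT` GONE;
* literal twins of lens-5's bite-point instances with the PROVED constant: `fdg_of_split_rangeCut_five_tf`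
  (`E′(1/20,1/8) ∧ UP(−0.7175) ∧ T′_5(A = 71/5000, κ_T = 1/200) ⟹ FDG` — the bite point `R = 5` survives: `0.0142·s⋆⁻³ − |t_5| ≈ 1.1·10⁻²`
  against the ceiling `1.63·10⁻²`) and `fdg_of_rangeCut_eight_tf` (unsplit, `R = 8`, `A = 5/1600`, level `−0.7174`);
* the crux BY NAME: `aperiodicFrustratedLawGap_of_split_rangeCut_tf` / `…_of_rangeCut_tf` (`MuEquilibriumDoor ∧ E′ ∧ UP ∧ residual`).

So beneath lens-5's cut the KNOWN-type piece is a theorem; what remains is `UP` (tree number, `…RangeCutUp` pending the farm) and the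
declared residual `T′_5` (now with `A = 71/5000` in place of `1/96`).  DEF-FREE; 0 sorry.  Prover hand 1, gen 12 (decomp-a2c),
--supports stmt-AtomisticToContinuum-27623.  [folklore chaining]
-/

noncomputable section

namespace Summit.AtomisticToContinuum.Crystallization.Theorems.FrustratedLawDichotomyTailFloor

open Summit.AtomisticToContinuum.Crystallization.Theorems.FrustratedLawDichotomyRangeCut

/-! ## 1. The tail floor in lens-5's currency -/

/-- ★ **TF PROVED**: `TailFloor R ((4/3)(1 + 1/(2R))³/R³)` for every `R > 0` (layer-cake constant). [folklore] -/
theorem tailFloor_holds {R : ℝ} (hR : 0 < R) : TailFloor R (4 / 3 * (1 + 1 / (2 * R)) ^ 3 / R ^ 3) :=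
  fun N y _ hsep => tail_floor_sharp hR N y hsep

/-- The dyadic-constant tail floor `TailFloor R ((128/21)(1 + 1/(4R))³/R³)` (weaker; kept for the record). [folklore] -/
theorem tailFloor_dyadic {R : ℝ} (hR : 0 < R) : TailFloor R (128 / 21 * (1 + 1 / (4 * R)) ^ 3 / R ^ 3) :=
  fun N y _ hsep => tail_floor hR N y hsep

/-- ★ Literal: `TailFloor 5 (71/5000)` (`A_5 = (4/3)(11/10)³/125 = 0.01420 ≤ 71/5000`; lens-5's intended mean-value value is `1/96`). -/
theorem tailFloor_five : TailFloor 5 (71 / 5000) := fun N y _ hsep => tail_floor_five N y hsep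

/-- Literal: `TailFloor 8 (5/1600)` (`A_8 = (4/3)(17/16)³/512 ≤ 5/1600`). -/
theorem tailFloor_eight : TailFloor 8 (5 / 1600) := fun N y _ hsep => tail_floor_eight_sharp N y hsep

/-! ## 2. Lens-5's kernels with the tail floor discharged -/

/-- **`T′ ⟸ UP ∧ T′_R`** (TF discharged): at range `R > 0` with `A = A_R`, price `κ_T > 0`. [folklore chaining] -/
theorem topologicalPricing_of_rangeCut_tf {η₀ η₁ R eUp κT CT : ℝ} (hR : 0 < R) (hU : PeriodicEnergyCeiling eUp) (hκ : 0 < κT)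
    (hF : FiniteRangeTopologicalPricing η₀ η₁ R (4 / 3 * (1 + 1 / (2 * R)) ^ 3 / R ^ 3) eUp κT CT) :
    TopologicalPricing η₀ η₁ :=
  topologicalPricing_of_rangeCut (tailFloor_holds hR) hU hκ hF

/-- **`FDG ⟸ E′ ∧ UP ∧ T′_R`** (TF discharged). [folklore chaining] -/
theorem fdg_of_split_rangeCut_tf {η₁ R eUp κT CT : ℝ} (h01 : (1 : ℝ) / 20 ≤ η₁) (hE : ElasticPricing (1 / 20) η₁)
    (hR : 0 < R) (hU : PeriodicEnergyCeiling eUp) (hκ : 0 < κT)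
    (hF : FiniteRangeTopologicalPricing (1 / 20) η₁ R (4 / 3 * (1 + 1 / (2 * R)) ^ 3 / R ^ 3) eUp κT CT) : FDG :=
  fdg_of_split_rangeCut h01 hE (tailFloor_holds hR) hU hκ hF

/-- **`FDG ⟸ UP ∧ FRG_R ∧ (eUp < e₁)`** (unsplit, TF discharged). [folklore chaining] -/
theorem fdg_of_rangeCut_tf {R eUp e₁ C : ℝ} (hR : 0 < R) (hU : PeriodicEnergyCeiling eUp)
    (hF : FiniteRangeFrustrationGap R (4 / 3 * (1 + 1 / (2 * R)) ^ 3 / R ^ 3) e₁ C) (he : eUp < e₁) : FDG :=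
  fdg_of_rangeCut (tailFloor_holds hR) hU hF he

/-- ★ **Split range cut at the bite point `R = 5` with the PROVED tail floor** (`A = 71/5000`, `η₁ = 1/8`, `κ_T = 1/200`, `eUp = −0.7175`):
`E′(1/20,1/8) ∧ UP(−0.7175) ∧ T′_5 ⟹ FDG` — lens-5's `fdg_of_split_rangeCut_five` with `hT` gone and `1/96 ↦ 71/5000`. [folklore chaining] -/
theorem fdg_of_split_rangeCut_five_tf {CT : ℝ} (hE : ElasticPricing (1 / 20) (1 / 8))
    (hU : PeriodicEnergyCeiling (-(7175 / 10000)))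
    (hF : FiniteRangeTopologicalPricing (1 / 20) (1 / 8) 5 (71 / 5000) (-(7175 / 10000)) (1 / 200) CT) : FDG :=
  fdg_of_split_rangeCut (by norm_num) hE tailFloor_five hU (by norm_num) hF

/-- **Unsplit range cut at `R = 8` with the PROVED tail floor** (`A = 5/1600`, level `e₁ = −0.7174 > eUp = −0.7175`):
`UP(−0.7175) ∧ FRG(8, 5/1600, −0.7174, C) ⟹ FDG`. [folklore chaining] -/
theorem fdg_of_rangeCut_eight_tf {C : ℝ} (hU : PeriodicEnergyCeiling (-(7175 / 10000)))
    (hF : FiniteRangeFrustrationGap 8 (5 / 1600) (-(7174 / 10000)) C) : FDG :=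
  fdg_of_rangeCut tailFloor_eight hU hF (by norm_num)

/-! ## 3. The crux BY NAME -/

/-- ★★ **`AperiodicFrustratedLawGap` (item 27623) from `MuEquilibriumDoor ∧ E′(1/20,η₁) ∧ UP(eUp) ∧ T′_R`** — lens-5 g33's split range cut
with the tail floor DISCHARGED (any `R > 0`, `A = (4/3)(1+1/(2R))³/R³`, `κ_T > 0`). [folklore chaining] -/
theorem aperiodicFrustratedLawGap_of_split_rangeCut_tf {η₁ R eUp κT CT : ℝ} (h01 : (1 : ℝ) / 20 ≤ η₁)
    (hDoor : Summit.AtomisticToContinuum.Crystallization.Theses.GrainCoreNetworkSplit.MuEquilibriumDoor)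
    (hE : ElasticPricing (1 / 20) η₁) (hR : 0 < R) (hU : PeriodicEnergyCeiling eUp) (hκ : 0 < κT)
    (hF : FiniteRangeTopologicalPricing (1 / 20) η₁ R (4 / 3 * (1 + 1 / (2 * R)) ^ 3 / R ^ 3) eUp κT CT) :
    Summit.AtomisticToContinuum.Crystallization.Theses.FrustratedLawDichotomy.AperiodicFrustratedLawGap :=
  aperiodicFrustratedLawGap_of_split_rangeCut h01 hDoor hE (tailFloor_holds hR) hU hκ hF

/-- **The crux from the split range cut at the bite point `R = 5`** (`η₁ = 1/8`, `A = 71/5000`, `κ_T = 1/200`, `eUp = −0.7175`):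
`MuEquilibriumDoor ∧ E′(1/20,1/8) ∧ UP(−0.7175) ∧ T′_5 ⟹ AperiodicFrustratedLawGap`. [folklore chaining] -/
theorem aperiodicFrustratedLawGap_of_split_rangeCut_five_tf {CT : ℝ}
    (hDoor : Summit.AtomisticToContinuum.Crystallization.Theses.GrainCoreNetworkSplit.MuEquilibriumDoor)
    (hE : ElasticPricing (1 / 20) (1 / 8)) (hU : PeriodicEnergyCeiling (-(7175 / 10000)))
    (hF : FiniteRangeTopologicalPricing (1 / 20) (1 / 8) 5 (71 / 5000) (-(7175 / 10000)) (1 / 200) CT) :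
    Summit.AtomisticToContinuum.Crystallization.Theses.FrustratedLawDichotomy.AperiodicFrustratedLawGap :=
  aperiodicFrustratedLawGap_of_fdg hDoor (fdg_of_split_rangeCut_five_tf hE hU hF)

/-- **The crux from the unsplit range cut** with the tail floor discharged:
`MuEquilibriumDoor ∧ UP(eUp) ∧ FRG(R, A_R, e₁, C) ∧ (eUp < e₁) ⟹ AperiodicFrustratedLawGap`. [folklore chaining] -/
theorem aperiodicFrustratedLawGap_of_rangeCut_tf {R eUp e₁ C : ℝ}
    (hDoor : Summit.AtomisticToContinuum.Crystallization.Theses.GrainCoreNetworkSplit.MuEquilibriumDoor)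
    (hR : 0 < R) (hU : PeriodicEnergyCeiling eUp)
    (hF : FiniteRangeFrustrationGap R (4 / 3 * (1 + 1 / (2 * R)) ^ 3 / R ^ 3) e₁ C) (he : eUp < e₁) :
    Summit.AtomisticToContinuum.Crystallization.Theses.FrustratedLawDichotomy.AperiodicFrustratedLawGap :=
  aperiodicFrustratedLawGap_of_rangeCut hDoor (tailFloor_holds hR) hU hF he

/-! ## 4. The honest PROVED-floor instances at `R = 9` (critic row 484 / lens-5 g34 erratum: the STRAINED population must
self-finance `ε_R + (eUp − e⋆)`, budget `ε_R ≤ 3.5·10⁻³`, `×2` at `1.75·10⁻³`; with the layer-cake floor `ε_9 ≈ 1.67·10⁻³`) -/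

/-- Literal: `TailFloor 9 (11/5000)` (`A_9 = (4/3)(19/18)³/729 = 2.151·10⁻³ ≤ 11/5000`; slack `(11/5000)·s⋆⁻³ − |t_9| ≈ 1.67·10⁻³`,
inside the `×2` budget of the strained population). [folklore] -/
theorem tailFloor_nine : TailFloor 9 (11 / 5000) := fun N y _ hsep => by
  have h := tail_floor_sharp (R := 9) (by norm_num) N y hsep
  have hs : 0 ≤ ∑ i, ((min (Literature.Geometry.DiscreteGeometry.nearestDist y i) 1) ^ 3)⁻¹ :=
    Finset.sum_nonneg fun i _ => inv_nonneg.2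
      (pow_nonneg (le_min (Literature.Geometry.DiscreteGeometry.nearestDist_nonneg y i) zero_le_one) 3)
  have hc : (4 : ℝ) / 3 * (1 + 1 / (2 * 9)) ^ 3 / 9 ^ 3 ≤ 11 / 5000 := by norm_num
  show -(11 / 5000 * ∑ i, ((min (Literature.Geometry.DiscreteGeometry.nearestDist y i) 1) ^ 3)⁻¹) ≤
    Literature.MathematicalPhysics.StatisticalMechanics.interactionEnergy
      (fun r => if r < 9 then 0 else Literature.MathematicalPhysics.StatisticalMechanics.lennardJones r) y
  nlinarith

/-- **Split range cut at `R = 9` with the PROVED floor** (`A = 11/5000`, `η₁ = 1/8`, `κ_T = 1/100`, `eUp = −0.7175`):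
`E′(1/20,1/8) ∧ UP(−0.7175) ∧ T′_9 ⟹ FDG`. [folklore chaining] -/
theorem fdg_of_split_rangeCut_nine_tf {CT : ℝ} (hE : ElasticPricing (1 / 20) (1 / 8))
    (hU : PeriodicEnergyCeiling (-(7175 / 10000)))
    (hF : FiniteRangeTopologicalPricing (1 / 20) (1 / 8) 9 (11 / 5000) (-(7175 / 10000)) (1 / 100) CT) : FDG :=
  fdg_of_split_rangeCut (by norm_num) hE tailFloor_nine hU (by norm_num) hF

/-- **Unsplit range cut at `R = 9` with the PROVED floor** (`A = 11/5000`, level `e₁ = −0.7174 > eUp = −0.7175`):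
`UP(−0.7175) ∧ FRG(9, 11/5000, −0.7174, C) ⟹ FDG`. [folklore chaining] -/
theorem fdg_of_rangeCut_nine_tf {C : ℝ} (hU : PeriodicEnergyCeiling (-(7175 / 10000)))
    (hF : FiniteRangeFrustrationGap 9 (11 / 5000) (-(7174 / 10000)) C) : FDG :=
  fdg_of_rangeCut tailFloor_nine hU hF (by norm_num)

/-- **The crux from the split range cut at `R = 9` with the PROVED floor**:
`MuEquilibriumDoor ∧ E′(1/20,1/8) ∧ UP(−0.7175) ∧ T′_9(A = 11/5000, κ_T = 1/100) ⟹ AperiodicFrustratedLawGap`. [folklore chaining] -/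
theorem aperiodicFrustratedLawGap_of_split_rangeCut_nine_tf {CT : ℝ}
    (hDoor : Summit.AtomisticToContinuum.Crystallization.Theses.GrainCoreNetworkSplit.MuEquilibriumDoor)
    (hE : ElasticPricing (1 / 20) (1 / 8)) (hU : PeriodicEnergyCeiling (-(7175 / 10000)))
    (hF : FiniteRangeTopologicalPricing (1 / 20) (1 / 8) 9 (11 / 5000) (-(7175 / 10000)) (1 / 100) CT) :
    Summit.AtomisticToContinuum.Crystallization.Theses.FrustratedLawDichotomy.AperiodicFrustratedLawGap :=
  aperiodicFrustratedLawGap_of_fdg hDoor (fdg_of_split_rangeCut_nine_tf hE hU hF)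

/-- **The crux from the unsplit range cut at `R = 9` with the PROVED floor**:
`MuEquilibriumDoor ∧ UP(−0.7175) ∧ FRG(9, 11/5000, −0.7174, C) ⟹ AperiodicFrustratedLawGap`. [folklore chaining] -/
theorem aperiodicFrustratedLawGap_of_rangeCut_nine_tf {C : ℝ}
    (hDoor : Summit.AtomisticToContinuum.Crystallization.Theses.GrainCoreNetworkSplit.MuEquilibriumDoor)
    (hU : PeriodicEnergyCeiling (-(7175 / 10000))) (hF : FiniteRangeFrustrationGap 9 (11 / 5000) (-(7174 / 10000)) C) :
    Summit.AtomisticToContinuum.Crystallization.Theses.FrustratedLawDichotomy.AperiodicFrustratedLawGap :=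
  aperiodicFrustratedLawGap_of_fdg hDoor (fdg_of_rangeCut_nine_tf hU hF)

end Summit.AtomisticToContinuum.Crystallization.Theorems.FrustratedLawDichotomyTailFloor
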